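import Summits.CriticalPhenomena.PercolationContinuityZ3.Theorems.Transplant.KNLevelsStepV
import HarnessLib

/-!
# F6 (generic), part 7a — Kozma–Nitzan Lemma 10, STEP V in SOURCE-ADDITIVE form: additive gluing in EVERY pinned weighting, no good/bad
# pattern split, no source hypothesis (NEG-SCOPE §B.19 (Q′-1); design owner p3-g11)

builds on p205010 (kernel theorem, internal audit signed; external expert review pending) — nothing in this file uses p205010 (the additive
gluing schema is a HYPOTHESIS `hAG` here; it is discharged by `KNLevels.additiveGluingSchema_KN_in`, part 6, in part 7b).
Lane `prim-bschramm`, seat `prim-bschramm-p3` (gen 11; N1 design owner); helper file (`--supports stmt-CriticalPhenomena-4575`).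

`LHyp.stepV_in` (part 3) proves `P(o ↔ T) > 1 − ε` from `P(≥ N contacts) > 1 − 2δ` by discarding the patterns `ξ` with `φ_ξ ≤ 1 − δ_{C3}`
and applying Conjecture 3 (a THRESHOLD statement) in the remaining pinned weightings `K_ξ`; the source enters through `1 − 2δ` and the
constants are tied by `12δ ≤ ε·δ_{C3}`.  With the ADDITIVE gluing inequality (`P(o ↔ A) − t ≤ P(o ↔ T)` whenever every relay reaches `T` with
probability `≥ 1 − t`) the same computation is LINEAR: in every `K_ξ`, `P_{K_ξ}(o ↔ T) ≥ φ_ξ − δ`; summing over `ξ` with (26)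
(`Σ_ξ p_ξ φ_ξ ≥ (1 − 3δ)·P(𝒢)`) and (19) (`P(𝒢) ≥ P(≥ N contacts) − (1 − p^{sB})^k`) gives
**`LHyp.stepV_additive`: `P_W(o ↔ T) ≥ P_W(≥ N contacts at level j) − 5δ`** — no `ε`, no `δ_{C3}`, no hypothesis on the source.
The proof is `stepV_in`'s through Claim D, then the additive summation.  Part 7b assembles Step II (whose proof is already additive) into
`P_W(o ↔ T) ≥ P_W(o ↔ B⟨0⟩) − 6δ` = the predicate `KNLevels.AdditiveTargetPropertyUP` (part 5) with `C = 6`.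
[cite: KozmaNitzan2024, §4 Lemma 10, pp. 19–22 (Steps III–V, (19), (26)); Conjecture 1 (p. 3)] [this work]
-/

noncomputable section

open MeasureTheory ProbabilityTheory
open scoped ENNReal

namespace Summit.CriticalPhenomena.PercolationContinuityZ3.Theorems

namespace Transplant

namespace KNLevels

open Literature.Probability.Percolation Literature.Probability.LatticeModels SimpleGraph

variable {V : Type*} [DecidableEq V] {G : SimpleGraph V} [G.LocallyFinite]

namespace LHyp

variable {L : LData G} {W : Sym2 V → unitInterval} {p : unitInterval} {D : Finset V} {R : ℕ}
variable (hL : LHyp L W p D R)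
include hL

open Classical in
/-- **Step V, source-additive** (KN pp. 21–22 with the additive gluing inequality in every pinned weighting `K_ξ`): at a level `j ≤ R`
with seed data `σ` (Step-III axioms, `(1 − p^{sB})^k ≤ δ`), a shell `S ⊆ B⟨j⟩ ∩ D` avoided by the seeds and containing the faces, the
Step-IV face estimate for every candidate contact (relays reliable to `T` INSIDE `Rg`), and the ADDITIVE gluing schema for finitely
supported weightings with source `o`, target `T` and `Rg`-reliable relays (the caller supplies `∅ ≠ T ⊆ Sfin` when instantiating it):
`P_W(≥ N contacts at level j) − 5δ ≤ P_W(o ↔ T)`. [cite: KozmaNitzan2024, §4 pp. 21–22 (Step V)] [this work] -/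
theorem stepV_additive [Countable V] {σ : SData V} {j : ℕ} (hσ : SHyp L j σ) (hj : j ≤ R) {Rg : Set V}
    {S T : Finset V} (hSX : S ⊆ L.X j) (hSD : S ⊆ D)
    (hSseed : ∀ x ∈ σ.K, ∀ e ∈ σ.seed x, e ∉ wireSet (↑S : Set V))
    {δ : ℝ} (hδ : 0 ≤ δ)
    (hIII : (1 - (p : ℝ) ^ σ.sB) ^ σ.k ≤ δ)
    (hUS : ∀ x ∈ σ.K, σ.face x ⊆ S)
    (hIV : ∀ x ∈ σ.K,
      1 - 3 * δ ≤ (prodBernoulli W).real {ω | ∃ u ∈ σ.face x,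
        1 - δ < (prodBernoulli (pinW W (wireSet (↑S : Set V)) ω)).real (⋃ t ∈ T, openConnIn Rg u t)})
    (hAG : ∀ (w : Sym2 V → unitInterval), FinSupp w L.Sfin → ∀ (A : Finset V), A ⊆ L.Sfin → ∀ t : ℝ, 0 ≤ t →
      (∀ a ∈ A, 1 - t ≤ (prodBernoulli w).real (⋃ t' ∈ T, openConnIn Rg a t')) →
      (prodBernoulli w).real (⋃ a ∈ A, openConn L.o a) - t ≤ (prodBernoulli w).real (⋃ t' ∈ T, openConn L.o t')) :
    (prodBernoulli W).real (L.Fail σ.N j)ᶜ - 5 * δ ≤ (prodBernoulli W).real (⋃ t ∈ T, openConn L.o t) := by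
  set μ := prodBernoulli W with hμ
  set OB := σ.K with hOB
  set F := pairsF S with hF
  have hFS : (↑F : Set (Sym2 V)) = wireSet (↑S : Set V) := coe_pairsF S
  have hSfin : S ⊆ L.Sfin := hSD.trans hL.DS
  -- the good sets `A_ξ` and the quantities `φ_ξ`
  set Aof : Finset (Sym2 V) → Finset V := fun P => S.filter fun u =>
    1 - δ < (prodBernoulli (pinW W (wireSet (↑S : Set V)) ↑P)).real (⋃ t ∈ T, openConnIn Rg u t) with hAof
  set φ : Finset (Sym2 V) → ℝ := fun P =>
    (prodBernoulli (pinW W ↑F ↑P)).real (⋃ a ∈ Aof P, openConn L.o a) with hφ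
  set cyl : Finset (Sym2 V) → Set (BondConfig V) := fun P => localCylinder ↑F ↑P with hcyl
  -- `μ(𝒢) ≥ μ(≥ N contacts) − δ` — (19), additively
  have hG : μ.real (L.Fail σ.N j)ᶜ - δ ≤ μ.real (L.Gev σ j) := by
    have hmG : MeasurableSet (L.Gev σ j) := LData.measurableSet_Gev j
    have h1 := hL.real_manyContacts_diff_Gev_le hσ hj
    have h2 : μ.real (L.Fail σ.N j)ᶜ ≤ μ.real ((L.Fail σ.N j)ᶜ \ L.Gev σ j) + μ.real (L.Gev σ j) := by
      rw [← measureReal_inter_add_sdiff (s := (L.Fail σ.N j)ᶜ) hmG, add_comm]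
      exact add_le_add le_rfl (measureReal_mono Set.inter_subset_right)
    linarith
  -- Claim D: `Σ_P μ(cyl P) φ(P) ≥ (1 - 3δ) μ(𝒢)` (verbatim from `stepV_in`)
  have hGood_det : ∀ x, DeterminedBy {ω | ∃ u ∈ σ.face x,
      1 - δ < (prodBernoulli (pinW W (wireSet (↑S : Set V)) ω)).real (⋃ t ∈ T, openConnIn Rg u t)} ↑F := by
    intro x
    rw [determinedBy_iff]
    intro ω ω' hω
    simp only [Set.mem_setOf_eq]
    have hag : ∀ e ∈ wireSet (↑S : Set V), e ∈ ω ↔ e ∈ ω' := by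
      intro e he
      rw [← hFS] at he
      have := Set.ext_iff.1 hω e
      simp only [Set.mem_inter_iff] at this
      exact ⟨fun h' => (this.1 ⟨h', he⟩).1, fun h' => (this.2 ⟨h', he⟩).1⟩
    refine exists_congr fun u => and_congr_right fun _ => ?_
    rw [pinW_congr W hag]
  have hFx_pin : ∀ P, ∀ x ∈ OB, (prodBernoulli (pinW W ↑F ↑P)).real (L.Fx σ j x) = μ.real (L.Fx σ j x) := by
    intro P x hx
    rw [hμ]
    refine (prodBernoulli_real_eq_of_determinedBy W _ (F := (↑F : Set (Sym2 V))ᶜ)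
      (fun e he => (pinW_apply_of_not_mem W ↑P he).symm) ?_ (LData.measurableSet_Fx j x)).symm
    rw [hFS]
    exact LData.determinedBy_Fx hSX hSseed hx
  have hφ_ge : ∀ P, P ⊆ F →
      ∑ x ∈ OB.filter (fun x => ∃ u ∈ σ.face x, u ∈ Aof P), μ.real (L.Fx σ j x) ≤ φ P := by
    intro P hP
    have hsub : (⋃ x ∈ OB.filter (fun x => ∃ u ∈ σ.face x, u ∈ Aof P), L.Fx σ j x) ⊆
        ⋃ a ∈ Aof P, openConn L.o a := by
      intro ω hω
      simp only [Set.mem_iUnion, exists_prop, Finset.mem_filter] at hω ⊢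
      obtain ⟨x, ⟨-, u, hu, huA⟩, hFx⟩ := hω
      exact ⟨u, huA, LData.openConn_of_mem_oSeed hσ (LData.Fx_subset_oSeed x hFx) hu⟩
    calc _ = ∑ x ∈ OB.filter (fun x => ∃ u ∈ σ.face x, u ∈ Aof P),
            (prodBernoulli (pinW W ↑F ↑P)).real (L.Fx σ j x) :=
          Finset.sum_congr rfl fun x hx => (hFx_pin P x (Finset.mem_filter.1 hx).1).symm
      _ = (prodBernoulli (pinW W ↑F ↑P)).real
            (⋃ x ∈ OB.filter (fun x => ∃ u ∈ σ.face x, u ∈ Aof P), L.Fx σ j x) := by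
          rw [measureReal_biUnion_finset]
          · intro x hx x' hx' hne
            exact LData.Fx_disjoint hne (Finset.mem_filter.1 hx').1 (Finset.mem_filter.1 hx).1
          · intro x _; exact LData.measurableSet_Fx j x
      _ ≤ φ P := measureReal_mono hsub (measure_ne_top _ _)
  have hD : (1 - 3 * δ) * μ.real (L.Gev σ j) ≤ ∑ P ∈ F.powerset, μ.real (cyl P) * φ P := by
    have hGx : ∀ x ∈ OB, μ.real {ω | ∃ u ∈ σ.face x,
        1 - δ < (prodBernoulli (pinW W (wireSet (↑S : Set V)) ω)).real (⋃ t ∈ T, openConnIn Rg u t)} =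
        ∑ P ∈ F.powerset.filter (fun P => ∃ u ∈ σ.face x, u ∈ Aof P), μ.real (cyl P) := by
      intro x hx
      rw [hμ, prodBernoulli_real_eq_sum_localCylinder W F (hGood_det x)]
      refine Finset.sum_congr ?_ fun P _ => rfl
      ext P
      simp only [Finset.mem_filter, Finset.mem_powerset, Set.mem_setOf_eq, hAof, and_congr_right_iff]
      intro _
      constructor
      · rintro ⟨u, hu, hg⟩; exact ⟨u, hu, hUS x hx hu, hg⟩
      · rintro ⟨u, hu, -, hg⟩; exact ⟨u, hu, hg⟩
    calc (1 - 3 * δ) * μ.real (L.Gev σ j)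
        = ∑ x ∈ OB, (1 - 3 * δ) * μ.real (L.Fx σ j x) := by
          rw [← LData.biUnion_Fx_eq_Gev, measureReal_biUnion_finset, Finset.mul_sum]
          · intro x hx x' hx' hne; exact LData.Fx_disjoint hne hx' hx
          · intro x _; exact LData.measurableSet_Fx j x
      _ ≤ ∑ x ∈ OB, μ.real {ω | ∃ u ∈ σ.face x,
            1 - δ < (prodBernoulli (pinW W (wireSet (↑S : Set V)) ω)).real (⋃ t ∈ T, openConnIn Rg u t)} *
            μ.real (L.Fx σ j x) :=
          Finset.sum_le_sum fun x hx => mul_le_mul_of_nonneg_right (hIV x hx) measureReal_nonneg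
      _ = ∑ x ∈ OB, ∑ P ∈ F.powerset.filter (fun P => ∃ u ∈ σ.face x, u ∈ Aof P),
            μ.real (cyl P) * μ.real (L.Fx σ j x) := by
          refine Finset.sum_congr rfl fun x hx => ?_
          rw [hGx x hx, Finset.sum_mul]
      _ = ∑ P ∈ F.powerset, ∑ x ∈ OB.filter (fun x => ∃ u ∈ σ.face x, u ∈ Aof P),
            μ.real (cyl P) * μ.real (L.Fx σ j x) := by
          rw [Finset.sum_comm' (t' := F.powerset)
            (s' := fun P => OB.filter (fun x => ∃ u ∈ σ.face x, u ∈ Aof P))]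
          intro x P
          simp only [Finset.mem_filter, Finset.mem_powerset]
          tauto
      _ = ∑ P ∈ F.powerset, μ.real (cyl P) *
            ∑ x ∈ OB.filter (fun x => ∃ u ∈ σ.face x, u ∈ Aof P), μ.real (L.Fx σ j x) := by
          refine Finset.sum_congr rfl fun P _ => ?_
          rw [Finset.mul_sum]
      _ ≤ ∑ P ∈ F.powerset, μ.real (cyl P) * φ P :=
          Finset.sum_le_sum fun P hP => mul_le_mul_of_nonneg_left (hφ_ge P (Finset.mem_powerset.1 hP)) measureReal_nonneg
  -- total mass of the cylinders is `1`
  have hcyl_sum : ∑ P ∈ F.powerset, μ.real (cyl P) = 1 := by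
    have := prodBernoulli_real_eq_sum_localCylinder W F (determinedBy_univ (↑F : Set (Sym2 V)))
    rw [probReal_univ] at this
    rw [hμ, this]
    refine (Finset.sum_congr ?_ fun P _ => rfl)
    ext P; simp
  -- Claim F, additive: in EVERY pinned weighting the additive gluing schema gives `φ(P) − δ ≤ P_{K_P}(o ↔ T)`
  have hF' : ∀ P ∈ F.powerset, φ P - δ ≤ (prodBernoulli (pinW W ↑F ↑P)).real (⋃ t ∈ T, openConn L.o t) := by
    intro P _
    have hsupp : FinSupp (pinW W ↑F ↑P) L.Sfin :=
      hL.fin.pinW (F := (↑F : Set (Sym2 V))) ↑P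
        (by rw [hFS]; exact KozmaNitzan.wireSet_mono (Finset.coe_subset.2 hSfin))
    refine hAG _ hsupp (Aof P) ((Finset.filter_subset _ _).trans hSfin) δ hδ fun a ha => ?_
    have hga := (Finset.mem_filter.1 ha).2
    rw [← hFS] at hga
    exact hga.le
  -- conclusion: total probability over the patterns
  have hmT : MeasurableSet (⋃ t ∈ T, openConn L.o t : Set (BondConfig V)) :=
    Finset.measurableSet_biUnion _ fun t _ => measurableSet_openConn_holds _ _
  have htot := prodBernoulli_real_inter_eq_sum_pinW W F hmT (determinedBy_univ (↑F : Set (Sym2 V)))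
  rw [Set.inter_univ] at htot
  simp only [Set.mem_univ, Finset.filter_true] at htot
  rw [hμ] at hG hD hcyl_sum
  rw [htot]
  have hGle1 : (prodBernoulli W).real (L.Gev σ j) ≤ 1 := measureReal_le_one
  calc (prodBernoulli W).real (L.Fail σ.N j)ᶜ - 5 * δ
      ≤ (1 - 3 * δ) * (prodBernoulli W).real (L.Gev σ j) - δ := by nlinarith
    _ ≤ ∑ P ∈ F.powerset, (prodBernoulli W).real (cyl P) * φ P - δ * ∑ P ∈ F.powerset, (prodBernoulli W).real (cyl P) := by
        rw [hcyl_sum, mul_one]; linarith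
    _ = ∑ P ∈ F.powerset, (prodBernoulli W).real (cyl P) * (φ P - δ) := by
        rw [Finset.mul_sum, ← Finset.sum_sub_distrib]
        refine Finset.sum_congr rfl fun P _ => by ring
    _ ≤ ∑ P ∈ F.powerset, (prodBernoulli W).real (cyl P) *
          (prodBernoulli (pinW W ↑F ↑P)).real (⋃ t ∈ T, openConn L.o t) :=
        Finset.sum_le_sum fun P hP => mul_le_mul_of_nonneg_left (hF' P hP) measureReal_nonneg

end LHyp

end KNLevels

end Transplant

end Summit.CriticalPhenomena.PercolationContinuityZ3.Theorems

end
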